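import Mathlib
import Summits.NavierStokesRegularity.NavierStokesRegularity.Theorems.WakeRatchetAdmissibleEternalBoundUnfed
import HarnessLib

/-!
# A shell that never GAINS energy from below vanishes; dead feed directions cannot carry a shell
# (support for `WakeRatchet.AdmissibleEternalBound`, stmt-NavierStokesRegularity-23197)

MODEL lattice ODEs only (Tao 2016 §4, §6.4); nothing in this file is a statement about the
Navier–Stokes equations, and no summit or rung is proved by it.

Let `W` be an admissible eternal solution of the renormalised lattice of a cancelling table (any covariant
viscosity `ν̂ ≥ 0`), `ε₀ > 0`.  The renormalised shell energy `ẽ_k = e^{2σ}‖W_k‖²` obeys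
`ẽ_k' = e^{2σ}(2Λ⟪W_k, A W_{k-1}⟫ - 2Λ⁻¹⟪W_{k+1}, A W_k⟫) - 2ν̂(1+ε₀)^{2k}e^{-σ} ẽ_k` (tree: `hasDerivAt_renE`).
If the incoming pairing `⟪W_k, A(W_{k-1})⟫` is NON-POSITIVE at all log-times (shell `k` never receives energy
from below: e.g. `W_{k-1} ≡ 0`, or `W_{k-1}` ranges in the zero cone of `A`, or shell `k` only backscatters),
then `ẽ_k' ≤ 2C_AΛ⁻¹‖W_{k+1}‖ ẽ_k`, so `e^{b}‖W_k(b)‖ ≤ e^{C_A M/Λ} e^{a}‖W_k(a)‖` for `a ≤ b` (a fence with zero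
source): a non-zero value at `b` forces `‖W_k(a)‖ ≥ c e^{-a}` on `(-∞, b]`, contradicting integrability.  Hence

* `eq_zero_of_inflow_nonpos` — a shell whose incoming flux pairing is `≤ 0` everywhere is identically zero;
* `eq_zero_of_deadFeed` — if `A(W_{k-1}(σ)) = 0` for all `σ` (the lower shell lives in the zero cone of the
  feed), then `W_k ≡ 0`, and (`eq_zero_above_of_deadFeed`) so is every shell above it (`WakeRatchetUnfed`).

This sharpens `WakeRatchetUnfed.eq_zero_of_unfed` (hypothesis `W_{k-1} ≡ 0`) and is the rigorous form of
«births only from below / dead directions of `A` cannot sustain a shell» used in the g5 analysis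
(`Cruxes/AdmissibleEternalBound/PROVER-g5-analysis.md`): every shell of a non-trivial admissible solution
receives energy from below at some log-time.
-/

noncomputable section

set_option linter.dupNamespace false

namespace Summit.NavierStokesRegularity.NavierStokesRegularity.Theorems

namespace WakeRatchetNoGain

open Filter Topology MeasureTheory Set intervalIntegral
open scoped RealInnerProductSpace
open Literature.Analysis.FluidPDE Literature.Analysis.FluidPDE.TaoCascade
open WakeRatchetFedSpike

variable {m : ℕ} {ε₀ νh : ℝ} {α : Fin m → Fin m → Fin m → ℤ × ℤ × ℤ → ℝ} {W : ℤ → ℝ → Em m}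

/-- **Fence with zero source.**  On a cancelling table, if shell `k` of an admissible eternal solution
never gains from below (`⟪W_k, A W_{k-1}⟫ ≤ 0` at all log-times), then for `a ≤ b`:
`e^{b}‖W_k(b)‖ ≤ exp(C_A Λ⁻¹ ∫_a^b ‖W_{k+1}‖) · e^{a}‖W_k(a)‖`.
[cite: Tao2016AveragedNS, §4 Lemma 4.1 (4.8)–(4.10) with (4.3), self-similar variables of §6.4; cell vocabulary (`IsEternalVisc`)] -/
theorem fence_of_inflow_nonpos (hε : 0 < ε₀) (hc : IsCancellingCoeff α) (hW : IsEternalVisc ε₀ νh α W)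
    (k : ℤ) (hin : ∀ σ, ⟪W k σ, tableA α (W (k - 1) σ)⟫ ≤ 0) {a b : ℝ} (hab : a ≤ b) :
    Real.exp b * ‖W k b‖ ≤
      Real.exp (fluxConst α * (bigLam ε₀)⁻¹ * ∫ s in a..b, ‖W (k + 1) s‖) * (Real.exp a * ‖W k a‖) := by
  have hS := table_sTable α hc
  have hΛpos : 0 < bigLam ε₀ := bigLam_pos (by linarith)
  have hκ : 0 ≤ fluxConst α * (bigLam ε₀)⁻¹ := mul_nonneg hS.CA_nonneg (inv_nonneg.2 hΛpos.le)
  have hWc : ∀ n : ℤ, Continuous (W n) := fun n =>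
    continuous_iff_continuousAt.2 fun x => (hW.law n x).continuousAt
  have hexp2 : ∀ x : ℝ, Real.exp (2 * x) = Real.exp x * Real.exp x := fun x => by
    rw [show (2 : ℝ) * x = x + x by ring, Real.exp_add]
  -- the renormalised energy `(e^{x}‖W_k x‖)²` and its derivative
  have hE : ∀ x, HasDerivAt (fun x => (Real.exp x * ‖W k x‖) ^ 2)
      (Real.exp (2 * x) * (2 * bigLam ε₀ * ⟪W k x, tableA α (W (k - 1) x)⟫
        - 2 * (bigLam ε₀)⁻¹ * ⟪W (k + 1) x, tableA α (W k x)⟫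
        - 2 * viscCoef ε₀ νh k x * ‖W k x‖ ^ 2)) x := by
    intro x
    have h := hasDerivAt_renE hW hc k x
    have hfun : (fun x => Real.exp (2 * x) * ‖W k x‖ ^ 2) = fun x => (Real.exp x * ‖W k x‖) ^ 2 := by
      funext x; rw [hexp2 x]; ring
    rw [hfun] at h
    exact h
  -- the differential inequality with ZERO source
  have hD : ∀ x, Real.exp (2 * x) * (2 * bigLam ε₀ * ⟪W k x, tableA α (W (k - 1) x)⟫
        - 2 * (bigLam ε₀)⁻¹ * ⟪W (k + 1) x, tableA α (W k x)⟫
        - 2 * viscCoef ε₀ νh k x * ‖W k x‖ ^ 2)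
      ≤ 2 * (Real.exp x * ‖W k x‖) * 0
        + 2 * (fluxConst α * (bigLam ε₀)⁻¹) * ‖W (k + 1) x‖ * (Real.exp x * ‖W k x‖) ^ 2 := by
    intro x
    have h1 : 2 * bigLam ε₀ * ⟪W k x, tableA α (W (k - 1) x)⟫ ≤ 0 := by
      have := hin x
      nlinarith [hΛpos]
    have h2 : |⟪W (k + 1) x, tableA α (W k x)⟫| ≤ ‖W (k + 1) x‖ * (fluxConst α * ‖W k x‖ ^ 2) :=
      (abs_real_inner_le_norm _ _).trans (mul_le_mul_of_nonneg_left (hS.normA _) (norm_nonneg _))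
    have h2' : -(2 * (bigLam ε₀)⁻¹ * ⟪W (k + 1) x, tableA α (W k x)⟫)
        ≤ 2 * (bigLam ε₀)⁻¹ * (‖W (k + 1) x‖ * (fluxConst α * ‖W k x‖ ^ 2)) := by
      have hi : 0 ≤ 2 * (bigLam ε₀)⁻¹ := by positivity
      have := neg_abs_le ⟪W (k + 1) x, tableA α (W k x)⟫
      nlinarith [h2, hi]
    have h3 : 0 ≤ 2 * viscCoef ε₀ νh k x * ‖W k x‖ ^ 2 := by
      have hv : 0 ≤ viscCoef ε₀ νh k x := by
        unfold viscCoef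
        have : 0 ≤ (1 + ε₀) ^ ((2 : ℝ) * k) := Real.rpow_nonneg (by linarith) _
        have := hW.nonneg
        positivity
      positivity
    have hexppos : 0 < Real.exp (2 * x) := Real.exp_pos _
    calc Real.exp (2 * x) * (2 * bigLam ε₀ * ⟪W k x, tableA α (W (k - 1) x)⟫
          - 2 * (bigLam ε₀)⁻¹ * ⟪W (k + 1) x, tableA α (W k x)⟫
          - 2 * viscCoef ε₀ νh k x * ‖W k x‖ ^ 2)
        ≤ Real.exp (2 * x) * (0 + 2 * (bigLam ε₀)⁻¹ * (‖W (k + 1) x‖ * (fluxConst α * ‖W k x‖ ^ 2)) - 0) := by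
          apply mul_le_mul_of_nonneg_left _ hexppos.le
          linarith
      _ = 2 * (Real.exp x * ‖W k x‖) * 0
          + 2 * (fluxConst α * (bigLam ε₀)⁻¹) * ‖W (k + 1) x‖ * (Real.exp x * ‖W k x‖) ^ 2 := by
          rw [hexp2 x]; ring
  have hsrc_c : Continuous fun _ : ℝ => (0 : ℝ) := continuous_const
  have hcof_c : Continuous fun s => ‖W (k + 1) s‖ := by
    have := hWc (k + 1); fun_prop
  have h := gronwall_sq_fence (h := fun x => Real.exp x * ‖W k x‖) (src := fun _ => (0 : ℝ)) hab hκ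
    (fun x => by positivity) hE hD hsrc_c hcof_c (fun _ => le_rfl) (fun s => norm_nonneg _)
  simpa using h

/-- **A shell that never gains from below is zero.**  On a cancelling table, a shell of an admissible
eternal solution (any `ν̂ ≥ 0`) whose incoming flux pairing `⟪W_k, A(W_{k-1})⟫` is non-positive at every
log-time vanishes identically.
[cite: Tao2016AveragedNS, §4 Lemma 4.1 (4.8)–(4.10) with (4.3), self-similar variables of §6.4; cell vocabulary (`IsEternalVisc`)] -/
theorem eq_zero_of_inflow_nonpos (hε : 0 < ε₀) (hc : IsCancellingCoeff α) (hW : IsEternalVisc ε₀ νh α W)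
    (k : ℤ) (hin : ∀ σ, ⟪W k σ, tableA α (W (k - 1) σ)⟫ ≤ 0) : ∀ σ, W k σ = 0 := by
  obtain ⟨M, hM⟩ := hW.action
  have hS := table_sTable α hc
  have hΛpos : 0 < bigLam ε₀ := bigLam_pos (by linarith)
  have hκ : 0 ≤ fluxConst α * (bigLam ε₀)⁻¹ := mul_nonneg hS.CA_nonneg (inv_nonneg.2 hΛpos.le)
  -- the uniform fence `e^{b}‖W_k(b)‖ ≤ e^{κM} e^{a}‖W_k(a)‖`
  have hfence : ∀ a b : ℝ, a ≤ b → Real.exp b * ‖W k b‖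
      ≤ Real.exp (fluxConst α * (bigLam ε₀)⁻¹ * M) * (Real.exp a * ‖W k a‖) := by
    intro a b hab
    refine (fence_of_inflow_nonpos hε hc hW k hin hab).trans (mul_le_mul_of_nonneg_right ?_ (by positivity))
    exact Real.exp_le_exp.2 (mul_le_mul_of_nonneg_left
      (intervalIntegral_le_integral (hM (k + 1)).1 (fun _ => norm_nonneg _) hab |>.trans (hM (k + 1)).2) hκ)
  intro b
  by_contra hb
  have hb' : 0 < ‖W k b‖ := norm_pos_iff.2 hb
  set K : ℝ := Real.exp (fluxConst α * (bigLam ε₀)⁻¹ * M) with hK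
  have hKpos : 0 < K := Real.exp_pos _
  set c : ℝ := Real.exp b * ‖W k b‖ / K with hcdef
  have hcpos : 0 < c := div_pos (mul_pos (Real.exp_pos _) hb') hKpos
  have hlow : ∀ a : ℝ, a ≤ b → c * Real.exp (-a) ≤ ‖W k a‖ := by
    intro a hab
    have h := hfence a b hab
    have h1 : c ≤ Real.exp a * ‖W k a‖ := by
      rw [hcdef, div_le_iff₀ hKpos]; linarith
    rw [Real.exp_neg]
    have hea : 0 < Real.exp a := Real.exp_pos a
    calc c * (Real.exp a)⁻¹ ≤ (Real.exp a * ‖W k a‖) * (Real.exp a)⁻¹ :=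
          mul_le_mul_of_nonneg_right h1 (inv_nonneg.2 hea.le)
      _ = ‖W k a‖ := by field_simp
  obtain ⟨a, hab, ha⟩ := exists_le_abs_lt (hM k).1 (mul_pos hcpos (Real.exp_pos (-b))) b
  rw [abs_of_nonneg (norm_nonneg _)] at ha
  have hmono : c * Real.exp (-b) ≤ c * Real.exp (-a) :=
    mul_le_mul_of_nonneg_left (Real.exp_le_exp.2 (by linarith)) hcpos.le
  linarith [hlow a hab]

/-- **Dead feed directions cannot carry a shell.**  If the feed of the lower shell vanishes at all
log-times, `A(W_{k-1}(σ)) = 0` (the lower shell ranges in the zero cone of `A`, «dead directions»), then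
`W_k ≡ 0`.
[cite: Tao2016AveragedNS, §4 Lemma 4.1 (4.8)–(4.10) with (4.3), self-similar variables of §6.4; cell vocabulary (`IsEternalVisc`)] -/
theorem eq_zero_of_deadFeed (hε : 0 < ε₀) (hc : IsCancellingCoeff α) (hW : IsEternalVisc ε₀ νh α W)
    (k : ℤ) (hA : ∀ σ, tableA α (W (k - 1) σ) = 0) : ∀ σ, W k σ = 0 :=
  eq_zero_of_inflow_nonpos hε hc hW k fun σ => by rw [hA σ, inner_zero_right]

/-- **… nor anything above it.**  Under the same dead-feed hypothesis every shell `j ≥ k` vanishes.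
[cite: Tao2016AveragedNS, §4 Lemma 4.1 (4.8)–(4.10) with (4.3), self-similar variables of §6.4; cell vocabulary (`IsEternalVisc`)] -/
theorem eq_zero_above_of_deadFeed (hε : 0 < ε₀) (hc : IsCancellingCoeff α) (hW : IsEternalVisc ε₀ νh α W)
    (k : ℤ) (hA : ∀ σ, tableA α (W (k - 1) σ) = 0) : ∀ j : ℤ, k ≤ j → ∀ σ, W j σ = 0 := by
  intro j hj
  induction j, hj using Int.leInduction with
  | base => exact eq_zero_of_deadFeed hε hc hW k hA
  | succ j hj ih => exact WakeRatchetUnfed.eq_zero_of_unfed hε hc hW (j + 1) (by simpa using ih)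

/-- **Every shell of a non-trivial admissible solution is fed from below somewhere**: if some shell is
non-zero at some log-time, then every shell `j` at or below it has a log-time at which the incoming pairing
`⟪W_j, A(W_{j-1})⟫` is strictly positive.
[cite: Tao2016AveragedNS, §4 Lemma 4.1 (4.8)–(4.10) with (4.3), self-similar variables of §6.4; cell vocabulary (`IsEternalVisc`)] -/
theorem exists_inflow_pos (hε : 0 < ε₀) (hc : IsCancellingCoeff α) (hW : IsEternalVisc ε₀ νh α W)
    {k : ℤ} (hk : ∃ σ, W k σ ≠ 0) {j : ℤ} (hj : j ≤ k) :
    ∃ σ, 0 < ⟪W j σ, tableA α (W (j - 1) σ)⟫ := by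
  by_contra h
  push Not at h
  have hz := eq_zero_of_inflow_nonpos hε hc hW j h
  obtain ⟨σ, hσ⟩ := WakeRatchetUnfed.exists_ne_zero_below hε hc hW hk j hj
  exact hσ (hz σ)

end WakeRatchetNoGain

end Summit.NavierStokesRegularity.NavierStokesRegularity.Theorems

end
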